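import Literature.NumberTheory.GaloisRepresentations.IdeleProjection
import HarnessLib

/-!
# A `C_Γ`-morphism `X ⟶ J̄` out of a layer-trivialised object is determined by its readouts
# `π_v ∘ f` at all places (uniqueness half of `Hom_{C_Γ}(X, J̄) = ∏'_v Hom_{Γ_{K_v}}(X, K̄_vˣ)`;
# Milne *ADT* I Lemma 4.13 (proof), Tate C–F VII §8 Prop. 8.1)

Topic `NumberTheory/GaloisRepresentations`; namespace `Literature.NumberTheory.GaloisRepresentations.IdeleReadout`.
One definition with body (`layerLiftRep`) and theorems; no named fact, no instance, no notation, no `sorry`;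
number fields in `Type`.  Sequel of door-c5 g17's `IdeleProjection` (THE idèle projections
`π_v = ideleProjection K v : J̄ → K̄_vˣ`), `IdeleBarHomOfLocalHoms` (`descendRep`, the layer assembly) and
`IdeleReadoutAssembly` (`ideleRep_hom_ext_of_readouts`: a `Gal(E/K)`-morphism `X ⟶ J_E` is determined by its local
readouts).

THE MATHEMATICS.  `K` a number field, `E/K` a finite Galois layer (`GalLayer K`), `X` an object of door-c4's category
`C_Γ = DiscreteRepCat ℤ Γ_K` on which `U_E = Gal(K̄/E)` acts trivially, `J̄ = lim→_E J_E = ideleBarD K` (door-c5 g16).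
A `C_Γ`-morphism `f : X ⟶ J̄` takes values in `J_E` (`GalLayerData.layerLift`); packaged as a `Gal(E/K)`-morphism
`layerLiftRep f : descendRep E X ⟶ J_E` it is determined by the local readouts
`placeEmb ∘ pr_{w_v} ∘ layerLift f = π_v ∘ f` (`finIdelePi_layerLift`) at the finite places and their archimedean
twins.  Hence (**`hom_ext_of_ideleProjection_eq`**, **`hom_ext_of_readoutInvariant_eq`**): two morphisms
`f, g : X ⟶ J̄` with `π_v ∘ f = π_v ∘ g` at EVERY place `v` of `K` are EQUAL.  This is the uniqueness companion of
door-c5 g17's existence theorem `exists_hom_readoutInvariant_eq` (the idèle ASSEMBLY), used by the local-to-global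
extension principle for `J̄`-valued morphisms (`IdeleExtensionLocalGlobal`, this seat).
HONEST FRAMING: no case of Poitou–Tate or BSD is proved here.

## References
* J. S. Milne, *Arithmetic Duality Theorems* (2nd ed. 2006), I Lemma 4.13 (proof). [MilneADT2006]
* J. W. S. Cassels, A. Fröhlich (eds.), *Algebraic Number Theory* (1967), Ch. VII (Tate) §7.3, §8 Prop. 8.1.
  [CasselsFrohlichANT1967]
-/

noncomputable section

open NumberField NumberField.InfinitePlace IsDedekindDomain Field CategoryTheory
open Literature.NumberTheory.Automorphic

namespace Literature.NumberTheory.GaloisRepresentations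

namespace IdeleReadout

open SemiLocal ArchHerbrand DiscreteGaloisModule IdeleCohomology IdeleClassBar HomDual DGMBridge
  Literature.Algebra.Homology Literature.Algebra.Homology.DiscreteRep

variable {K : Type} [Field K] [NumberField K] (E : GalLayer K)
variable {X : DiscreteRepCat ℤ (absoluteGaloisGroup K)}
  (hX : ∀ σ ∈ E.openNormalSubgroup, ∀ x : X.obj.V, X.obj.ρ σ x = x)

/-! ## §1 The layer lift of `f : X ⟶ J̄` as a `Gal(E/K)`-morphism `X ⟶ J_E` -/

/-- **The layer lift of `f : X ⟶ J̄` as a `Gal(E/K)`-morphism `descendRep E X ⟶ J_E`** (door-c5 g16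
`GalLayerData.layerLift`, equivariant by `layerLift_smul`). [cite: CasselsFrohlichANT1967, Ch. VII §8 Prop. 8.1] -/
def layerLiftRep (f : X ⟶ ideleBarD K) :
    haveI := E.numberField
    descendRep E X hX ⟶ IdeleClassGroup.ideleRep K E.1 :=
  haveI := E.numberField
  letI : Module ℤ X.obj.V := X.obj.hV2
  Rep.ofHom
    ⟨{ toFun := fun x => (ideleData K).layerLift E hX f x
       map_add' := fun x x' => map_add _ x x'
       map_smul' := fun c x => by
         have h := map_intCast_smul ((ideleData K).layerLift E hX f) ℤ ℤ c x
         rw [RingHom.id_apply]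
         exact h },
      fun τ => LinearMap.ext fun x => by
        obtain ⟨σ, rfl⟩ := E.restrictHom_surjective τ
        change (ideleData K).layerLift E hX f (descendρ E X hX (E.restrictHom σ) x) =
          (ideleData K).ρ E (E.restrictHom σ) ((ideleData K).layerLift E hX f x)
        rw [descendρ_restrictHom_apply]
        exact GalLayerData.layerLift_smul _ E hX f σ x⟩

/-- Unfolding: `layerLiftRep f x = layerLift E f x`. [cite: CasselsFrohlichANT1967, Ch. VII §8 Prop. 8.1] -/
@[simp] theorem layerLiftRep_hom_apply (f : X ⟶ ideleBarD K) (x : X.obj.V) :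
    (haveI := E.numberField; (layerLiftRep E hX f).hom x) = (ideleData K).layerLift E hX f x := rfl

/-- **The finite readouts of the layer lift are `π_v ∘ f`**: `localReadout v ιE (layerLiftRep f ≫ placeProj v) x
= π_{inr v} (f x)`. [cite: MilneADT2006, I Lemma 4.13 (proof)] -/
theorem localReadout_layerLiftRep_placeProj (f : X ⟶ ideleBarD K) (v : HeightOneSpectrum (𝓞 K)) (x : X.obj.V) :
    (haveI := E.numberField; haveI := E.isGalois;
      localReadout v (layerEmb E) (layerLiftRep E hX f ≫ placeProj v) x) =
      (ideleProjection K (Sum.inr v)).toAddMonoidHom (f.hom.hom x) := by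
  haveI := E.numberField
  haveI := E.isGalois
  rw [localReadout_comp_placeProj_apply, ideleProjection_inr_layerLift v E hX f x]
  rfl

/-- **The archimedean readouts of the layer lift are `π_v ∘ f`.** [cite: MilneADT2006, I Lemma 4.13 (proof)] -/
theorem archLocalReadout_layerLiftRep_infPlaceProj (f : X ⟶ ideleBarD K) (v : InfinitePlace K) (x : X.obj.V) :
    (haveI := E.numberField; haveI := E.isGalois;
      archLocalReadout v (layerEmb E) (layerLiftRep E hX f ≫ infPlaceProj v) x) =
      (ideleProjection K (Sum.inl v)).toAddMonoidHom (f.hom.hom x) := by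
  haveI := E.numberField
  haveI := E.isGalois
  rw [archLocalReadout_comp_infPlaceProj_apply, ideleProjection_inl_layerLift v E hX f x]
  rfl

/-! ## §2 Uniqueness: `π_v ∘ f = π_v ∘ g` at every place forces `f = g` -/

include hX in
/-- **A morphism `X ⟶ J̄` out of a `U_E`-trivial `X` is determined by the values `π_v (f x)` at all places.**
[cite: MilneADT2006, I Lemma 4.13 (proof)] [cite: CasselsFrohlichANT1967, Ch. VII §7.3, §8 Prop. 8.1] -/
theorem hom_ext_of_ideleProjection_eq {f g : X ⟶ ideleBarD K}
    (h : ∀ (v : Place K) (x : X.obj.V),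
      (ideleProjection K v).toAddMonoidHom (f.hom.hom x) = (ideleProjection K v).toAddMonoidHom (g.hom.hom x)) :
    f = g := by
  haveI := E.numberField
  haveI := E.isGalois
  -- the two layer lifts have the same readouts, hence agree
  have hlift : layerLiftRep E hX f = layerLiftRep E hX g :=
    ideleRep_hom_ext_of_readouts (layerEmb E)
      (fun v => AddMonoidHom.ext fun x => by
        rw [localReadout_layerLiftRep_placeProj, localReadout_layerLiftRep_placeProj]
        exact h (Sum.inr v) x)
      (fun v => AddMonoidHom.ext fun x => by
        rw [archLocalReadout_layerLiftRep_infPlaceProj, archLocalReadout_layerLiftRep_infPlaceProj]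
        exact h (Sum.inl v) x)
  -- and a morphism into the limit is the class of its layer lift
  rw [← (ideleData K).ofLayerHom_layerLift E hX f, ← (ideleData K).ofLayerHom_layerLift E hX g]
  have hval : ∀ x : X.obj.V, (ideleData K).layerLift E hX f x = (ideleData K).layerLift E hX g x := fun x => by
    rw [← layerLiftRep_hom_apply E hX f x, ← layerLiftRep_hom_apply E hX g x, hlift]
  have key : ∀ (φ₁ φ₂ : X.obj.V →+ (ideleData K).V E) (h₁ : ∀ (σ : absoluteGaloisGroup K) (x : X.obj.V),
      φ₁ (X.obj.ρ σ x) = (ideleData K).ρ E (E.restrictHom σ) (φ₁ x)) (h₂ : ∀ (σ : absoluteGaloisGroup K) (x : X.obj.V),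
      φ₂ (X.obj.ρ σ x) = (ideleData K).ρ E (E.restrictHom σ) (φ₂ x)),
      φ₁ = φ₂ → (ideleData K).ofLayerHom E φ₁ h₁ = (ideleData K).ofLayerHom E φ₂ h₂ := by
    rintro φ₁ φ₂ h₁ h₂ rfl
    rfl
  exact key _ _ _ _ (AddMonoidHom.ext hval)

variable [Module.Finite ℤ (LCarrier X)]

include hX in
/-- **A morphism `X ⟶ J̄` out of a `U_E`-trivial finite-type `X` is determined by its readout invariants
`π_v ∘ f ∈ Hom_ℤ(X|_v, K̄_vˣ)^{Γ_{K_v}}` at all places** — the uniqueness companion of door-c5 g17's assembly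
`exists_hom_readoutInvariant_eq`. [cite: MilneADT2006, I Lemma 4.13 (proof)] [cite: CasselsFrohlichANT1967, Ch. VII §8 Prop. 8.1] -/
theorem hom_ext_of_readoutInvariant_eq {f g : X ⟶ ideleBarD K}
    (h : ∀ v : Place K, readoutInvariant (ideleProjection K v) X f = readoutInvariant (ideleProjection K v) X g) :
    f = g :=
  hom_ext_of_ideleProjection_eq E hX fun v x => by
    have hv := LinearMap.congr_fun (congrArg (fun F => ((F.1 :
      DiscreteRep.HomCarrier (LCarrier X) (UnitsCarrier (Place.Completion v))) :
        LCarrier X →ₗ[ℤ] UnitsCarrier (Place.Completion v))) (h v)) (LCarrier.of X x)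
    rw [coe_readoutInvariant, coe_readoutInvariant, readoutMap_apply, readoutMap_apply, LCarrier.val_of] at hv
    exact hv

include hX in
/-- **`f ↦ (π_v ∘ f)_v` is injective** on `Hom_{C_Γ}(X, J̄)` for a `U_E`-trivial finite-type `X`.
[cite: MilneADT2006, I Lemma 4.13 (proof)] -/
theorem readoutInvariant_injective :
    Function.Injective fun f : X ⟶ ideleBarD K => fun v : Place K => readoutInvariant (ideleProjection K v) X f :=
  fun _ _ hfg => hom_ext_of_readoutInvariant_eq E hX fun v => congrFun hfg v

end IdeleReadout

end Literature.NumberTheory.GaloisRepresentations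

end
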